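import Literature.AnabelianGeometry.EtaleTheta.SettingBridgeCuspLaws
import Literature.AnabelianGeometry.EtaleTheta.Discharge.Sec2Prop24ModelCharacteristic
import HarnessLib

/-!
# [EtTh] §1: the once-punctured parameter bundle FROM the cusp laws — (P3) is a theorem of the group-level
# datum alone, (P4) a theorem of the section law; the slim constructor `OncePuncturedData.ofCuspLaws`

S. Mochizuki, *The étale theta function and its Frobenioid-theoretic manifestations*, Publ. RIMS **45** (2009)
[EtTh], §1 p. 13 («any decomposition group of a cusp of `Y^log`» — decomposition groups of cusps lie in
`Π^tp_Y = Ker(Π^tp_X ↠ Z)` and map onto `G_K`), Def. 2.1 p. 35 (the cusp is `K`-rational)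
[cite: MochizukiEtTh2009, §1 p.13]; [SemiAnbd] Thm. 6.8 (decomposition groups in a tempered fundamental group
are compact) [cite: MochizukiSemiAnbd2006, §6 p.71].

Cell abc-iut, layer L2, seat abc-iut-L2-t7 (gen 4) — OWNER of `ThetaSetting.OncePuncturedData` (`SettingBridge`)
and of the census predicate `ThetaSetting.CuspLaws` (`SettingBridgeCuspLaws`, 13:00Z census items C16/C9/C3).
DEFS-FREEZE class (b): ONE construction over existing interfaces (no field added or removed anywhere; 0 instances,
0 notation, no `Prop` fact) + proof-only lemmas.  The census note of abc-iut-L2-d3 (`Sec1CuspSectionConsequences`: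
«(P3)/(P4) of `OncePuncturedData` are derivable from a continuous section») is sharpened and turned into a
constructor the owner endorses as the v-next direction of the bundle:

* `ThetaSetting.decomp_le_GtpY_of_groupLevelData` — (P3) needs no cusp law: given the bundle's own parent
  `GroupLevelData` (abc-iut-L3: `Π^tp_X` tempered + Galois-countable) EVERY decomposition group `D_x` (cusp or
  not) is compact ([SemiAnbd] Thm. 6.8, `TemperedCurve.decompCompact_of_groupLevelData`) and compact subgroups of
  `Π^tp_X` die in the discrete torsion-free `Z` (abc-iut-L2's `le_GtpY_of_isCompact`,
  `Sec2Prop24ModelCharacteristic`), so `D_x ≤ Π^tp_Y` (one line; it is the internal feed of the constructor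
  below).  The STRONGER statement of record — (P3) from the ROOT `TemperedCurve` fields alone, no group-level
  datum, via «`Hom(profinite, ℤ) = 0`» — is abc-iut-w6-d092's «P3-UNCONDITIONAL» (announced 11:42Z, 2026-08-26),
  not restated here;
* **`ThetaSetting.OncePuncturedData.ofCuspLaws`** — the SLIM CONSTRUCTOR: from the group-level datum `d`,
  (P1) `Ker(Π_X → G_{ℚ_p}) = Δ_X`, (P2) «a cusp exists», the cusp laws `CuspLaws` and the guard `IsEtThOrigin`, the
  full bundle — (P3) by the previous item, (P4) `aug(D_x) = G_K` from the section law C9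
  (`CuspLaws.map_aug_decomp`); `ofCuspLaws_toGroupLevelData` (`rfl`);
* `ThetaSetting.nonempty_oncePuncturedData_iff_of_cuspLaws` — under `CuspLaws`, the bundle is inhabited iff
  {group-level datum, (P1), (P2), guard} are.

OWNER'S V-NEXT NOTE (post-window, no change filed here): `OncePuncturedData` v2 := `GroupLevelData` + (P1) + (P2)
+ (P5) [+ `CuspLaws` if the census later wants the laws as a field]; (P3) and (P4) become the theorems above.
HONEST FRAMING: a construction over abstract data; nothing asserts that any genuine curve supplies the inputs;
[EtTh]/[SemiAnbd] are refereed inputs; no side is taken on [IUTchIII] Cor. 3.12; typed ≠ proved.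
-/

noncomputable section

namespace Literature.AnabelianGeometry.EtaleTheta

open Literature.AnabelianGeometry.SemiGraphs _root_.Topology

namespace ThetaSetting

variable {p : ℕ} [Fact p.Prime] (D : ThetaSetting p)

/-- **(P3) for every point, from the group-level datum alone**: given `GroupLevelData` (so that every
decomposition group is compact, [SemiAnbd] Thm. 6.8) each `D_x` lies in `Π^tp_Y = Ker(Π^tp_X ↠ Z)` (compact
subgroups have trivial image in the discrete torsion-free `Z`). [cite: MochizukiEtTh2009, §1 p.13] -/
theorem decomp_le_GtpY_of_groupLevelData (d : D.toTemperedCurve.GroupLevelData) (x : D.Pt) :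
    D.decomp x ≤ D.GtpY :=
  D.le_GtpY_of_isCompact _ (D.toTemperedCurve.decompCompact_of_groupLevelData d x)

/-- The same in the spelling of the bundle's field (P3): `D_x ≤ Ker(toZ)`. [cite: MochizukiEtTh2009, §1 p.13] -/
theorem decomp_le_ker_toZ_of_groupLevelData (d : D.toTemperedCurve.GroupLevelData) (x : D.Pt) :
    D.decomp x ≤ D.toZ.ker :=
  D.decomp_le_GtpY_of_groupLevelData d x

variable {D}

/-- The bundle's (P3) holds for ALL points, not only cusps (its own `GroupLevelData` parent suffices).
[cite: MochizukiEtTh2009, §1 p.13] -/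
theorem OncePuncturedData.decomp_le_GtpY (e : D.OncePuncturedData) (x : D.Pt) : D.decomp x ≤ D.GtpY :=
  D.decomp_le_GtpY_of_groupLevelData e.toGroupLevelData x

/-- **The slim constructor of the once-punctured parameter bundle from the cusp laws**: group-level datum,
(P1), (P2), `CuspLaws`, guard ⟹ `OncePuncturedData` — (P3) from the group-level datum
(`decomp_le_ker_toZ_of_groupLevelData`), (P4) from the section law C9 (`CuspLaws.map_aug_decomp`).
[cite: MochizukiEtTh2009, §1 p.13] -/
def OncePuncturedData.ofCuspLaws (d : D.toTemperedCurve.GroupLevelData)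
    (hker : D.augHat.toMonoidHom.ker = D.DeltaHat) (hcusp : ∃ x : D.Pt, D.IsCusp x) (hL : D.CuspLaws)
    (hO : D.IsEtThOrigin) : D.OncePuncturedData where
  toGroupLevelData := d
  ker_augHat := hker
  exists_cusp := hcusp
  decomp_le_ker_toZ x _ := D.decomp_le_ker_toZ_of_groupLevelData d x
  map_aug_decomp _ hx := hL.map_aug_decomp hx
  origin := hO

/-- The slim constructor keeps the group-level datum. [cite: MochizukiEtTh2009, §1 p.13] -/
@[simp] theorem OncePuncturedData.ofCuspLaws_toGroupLevelData (d : D.toTemperedCurve.GroupLevelData)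
    (hker : D.augHat.toMonoidHom.ker = D.DeltaHat) (hcusp : ∃ x : D.Pt, D.IsCusp x) (hL : D.CuspLaws)
    (hO : D.IsEtThOrigin) :
    (OncePuncturedData.ofCuspLaws d hker hcusp hL hO).toGroupLevelData = d := rfl

/-- Under the cusp laws the bundle is inhabited iff its four law-free ingredients are: the group-level datum,
(P1), (P2) and the guard. [cite: MochizukiEtTh2009, §1 p.13] -/
theorem nonempty_oncePuncturedData_iff_of_cuspLaws (hL : D.CuspLaws) :
    Nonempty D.OncePuncturedData ↔
      Nonempty D.toTemperedCurve.GroupLevelData ∧ D.augHat.toMonoidHom.ker = D.DeltaHat ∧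
        (∃ x : D.Pt, D.IsCusp x) ∧ D.IsEtThOrigin := by
  constructor
  · rintro ⟨e⟩
    exact ⟨⟨e.toGroupLevelData⟩, e.ker_augHat, e.exists_cusp, e.origin⟩
  · rintro ⟨⟨d⟩, hker, hcusp, hO⟩
    exact ⟨OncePuncturedData.ofCuspLaws d hker hcusp hL hO⟩

/-- With the cusp laws and the bundle, every cusp `x` has `D_x ≤ Π^tp_Y` AND `aug(D_x) = G_K` AND a continuous
section AND `toTheta(I_x) = Δ_Θ` — the four printed properties of «the decomposition group of the unique cusp» in
one place (p. 13, p. 35). [cite: MochizukiEtTh2009, Def 2.1 p.35] -/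
theorem CuspLaws.cusp_profile (hL : D.CuspLaws) (e : D.OncePuncturedData) {x : D.Pt} (hx : D.IsCusp x) :
    D.decomp x ≤ D.GtpY ∧ (D.decomp x).map D.aug.toMonoidHom = D.GK ∧
      (∃ s : ↥D.GK →* D.PiTemp, (∀ σ, s σ ∈ D.decomp x) ∧ (∀ σ, D.aug (s σ) = (σ : GQp p)) ∧ Continuous s) ∧
      (D.inertia x).map D.toTheta = D.DeltaTheta ∧ IsCompact (D.decomp x : Set D.PiTemp) :=
  ⟨e.decomp_le_GtpY x, hL.map_aug_decomp hx, hL.exists_section hx, hL.map_toTheta_inertia x hx,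
    e.isCompact_decomp x⟩

end ThetaSetting

end Literature.AnabelianGeometry.EtaleTheta

end
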